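import Literature.Analysis.FunctionSpaces.PeriodicLogCost
import Literature.Analysis.FluidPDE.HardSpherePhaseSpaceProofs
import Literature.MathematicalPhysics.KineticTheory.HardSphereEuler
import HarnessLib

/-!
# Integration by parts along free flights, tested (stub `flight` of the K2R refutation line)

Route `EnskogAdjointDuality` of `AtomisticToContinuum/HydrodynamicLimit`, crux K2R
`AdjointEnskogTestFamilyR` (stmt-AtomisticToContinuum-11592), line `refutation`, stub `stub_flight`:
for a jointly continuous kinetic test function `Φ(s, x, v)` on `[0,1] × 𝕋³ × ℝ³` of quadratic velocity
growth, `C¹` along every free flight `r ↦ (r, x + r v, v)`, a jointly measurable `Ł` of polynomial growth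
with `|∂_r Φ(r, x + (r-s)v, v)|_{r=s} + Ł(s, x, v)| ≤ η (1+|v|²)` on `[0,1] × 𝕋³ × ℝ³`, a test function
`Z(s, x) = ζ(s) ξ(x)` (`ζ ∈ C¹` vanishing outside `(0,1)`, `ξ ∈ {cos 2πx₀, sin 2πx₀}`) and a velocity
weight `Θ` with `∫ |Θ| (1+|v|²)⁴ < ∞`:
`|∫₀¹ ∫_{𝕋³} ∫ Θ(v) (-(∂_s Z + v·∇_x Z) Φ + Z Ł)| ≤ η ‖ζ‖_{L¹} ∫ |Θ| (1+|v|²)`.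
Proof: the shear `(s, y, v) ↦ (s, y + s v, v)` preserves `ds dy dv` (Haar measure on `𝕋³` is translation
invariant), so by Fubini the left-hand side is `∫_{𝕋³}∫ (∫₀¹ flight integrand ds) dy dv`; on each flight
one integrates by parts `z G`, `z(r) = Z(r, y + rv)`, `G(r) = Φ(r, y + rv, v)` (`z(0) = z(1) = 0`), and
the defect inequality bounds the remainder `∫ z (G' + Ł)` by `η (1+|v|²) ∫ |ζ|`.
References: H. Spohn, *Large Scale Dynamics of Interacting Particles* (1991), Part I §2.3 (free
streaming on the torus); folklore calculus and measure theory.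
-/

noncomputable section

namespace Summit.AtomisticToContinuum.HydrodynamicLimit.Theorems.EnskogAdjointDuality

open MeasureTheory Set Filter
open scoped InnerProductSpace Real Topology
open Literature.MathematicalPhysics.KineticTheory Literature.Analysis.FluidPDE Literature.Analysis.FunctionSpaces

-- `T3 = UnitAddTorus (Fin 3)`, `V3 = EuclideanSpace ℝ (Fin 3)` (`Literature.MathematicalPhysics.KineticTheory`).

/-! ## One-dimensional calculus along a flight -/

/-- The flight profile of `ξ`: `t ↦ cos(2πt)` (resp. `sin(2πt)`) has derivative `-(2π) sin(2πt)`
(resp. `(2π) cos(2πt)`). [folklore] -/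
theorem k2r_ref_fl_hasDerivAt_prof (trig : Bool) (t : ℝ) :
    HasDerivAt (fun t : ℝ => if trig then Real.cos (2 * π * t) else Real.sin (2 * π * t))
      (if trig then -(2 * π) * Real.sin (2 * π * t) else (2 * π) * Real.cos (2 * π * t)) t := by
  have hlin : HasDerivAt (fun t : ℝ => 2 * π * t) (2 * π) t := by
    simpa using (hasDerivAt_id t).const_mul (2 * π)
  cases trig
  · simp only [Bool.false_eq_true, if_false]
    convert hlin.sin using 1
    ring
  · simp only [if_true]
    convert hlin.cos using 1
    ring

/-- `|cos(2πt)|, |sin(2πt)| ≤ 1` and `|-(2π) sin(2πt)|, |(2π) cos(2πt)| ≤ 2π`. [folklore] -/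
theorem k2r_ref_fl_abs_prof_le (trig : Bool) (t : ℝ) :
    |(if trig then Real.cos (2 * π * t) else Real.sin (2 * π * t))| ≤ 1 ∧
    |(if trig then -(2 * π) * Real.sin (2 * π * t) else (2 * π) * Real.cos (2 * π * t))| ≤ 2 * π := by
  have h2π : (0 : ℝ) ≤ 2 * π := by positivity
  cases trig
  · simp only [Bool.false_eq_true, if_false, abs_mul, abs_of_nonneg h2π]
    exact ⟨Real.abs_sin_le_one _, mul_le_of_le_one_right h2π (Real.abs_cos_le_one _)⟩
  · simp only [if_true, abs_mul, abs_neg, abs_of_nonneg h2π]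
    exact ⟨Real.abs_cos_le_one _, mul_le_of_le_one_right h2π (Real.abs_sin_le_one _)⟩

/-- **Integration by parts along one flight.** If `G` is `C¹` on `[0,1]`, `z` is differentiable with
continuous derivative `z'` and `z(0) = z(1) = 0`, `|z| ≤ b` with `b` continuous, `L` is measurable on `[0,1]`
and `|G'(s) + L(s)| ≤ e` on `[0,1]` (`G'` the derivative within `[0,1]`), then
`|∫₀¹ (-z' G + z L)| ≤ e ∫₀¹ b` (since `∫₀¹ (z' G + z G') = z(1)G(1) - z(0)G(0) = 0`). [folklore] -/
theorem k2r_ref_fl_flight_ibp {G z z' b L : ℝ → ℝ} {e : ℝ} (hG : ContDiffOn ℝ 1 G (Icc 0 1))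
    (hz : ∀ r, HasDerivAt z (z' r) r) (hz'c : Continuous z') (hz0 : z 0 = 0) (hz1 : z 1 = 0)
    (hb : Continuous b) (hzb : ∀ s, |z s| ≤ b s)
    (hLm : AEStronglyMeasurable L (volume.restrict (Icc 0 1)))
    (hdef : ∀ s ∈ Icc (0 : ℝ) 1, |derivWithin G (Icc 0 1) s + L s| ≤ e) :
    |∫ s in Icc (0 : ℝ) 1, (-z' s * G s + z s * L s)| ≤ e * ∫ s in Icc (0 : ℝ) 1, b s := by
  have hzc : Continuous z := continuous_iff_continuousAt.2 fun r => (hz r).continuousAt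
  have hGc : ContinuousOn G (Icc 0 1) := hG.continuousOn
  have hDc : ContinuousOn (derivWithin G (Icc 0 1)) (Icc 0 1) :=
    hG.continuousOn_derivWithin (uniqueDiffOn_Icc zero_lt_one) le_rfl
  have hPc : ContinuousOn (fun r => z' r * G r + z r * derivWithin G (Icc 0 1) r) (Icc 0 1) :=
    (hz'c.continuousOn.mul hGc).add (hzc.continuousOn.mul hDc)
  -- the fundamental theorem of calculus for `z G` on `[0, 1]`
  have hFTC : ∫ s in Icc (0 : ℝ) 1, (z' s * G s + z s * derivWithin G (Icc 0 1) s) = 0 := by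
    have hderiv : ∀ r ∈ Ioo (0 : ℝ) 1,
        HasDerivAt (fun r => z r * G r) (z' r * G r + z r * derivWithin G (Icc 0 1) r) r := by
      intro r hr
      have hnhds : Icc (0 : ℝ) 1 ∈ 𝓝 r := Icc_mem_nhds hr.1 hr.2
      have hd : DifferentiableAt ℝ G r :=
        ((hG.differentiableOn one_ne_zero) r (Ioo_subset_Icc_self hr)).differentiableAt hnhds
      rw [derivWithin_of_mem_nhds hnhds]
      exact (hz r).mul hd.hasDerivAt
    have hint : IntervalIntegrable (fun r => z' r * G r + z r * derivWithin G (Icc 0 1) r) volume 0 1 :=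
      ContinuousOn.intervalIntegrable (by rwa [uIcc_of_le zero_le_one])
    have hcont : ContinuousOn (fun r => z r * G r) (Icc 0 1) := hzc.continuousOn.mul hGc
    have h := intervalIntegral.integral_eq_sub_of_hasDerivAt_of_le zero_le_one hcont hderiv hint
    rw [integral_Icc_eq_integral_Ioc, ← intervalIntegral.integral_of_le zero_le_one, h, hz0, hz1]
    ring
  have hbe : IntegrableOn (fun s => b s * e) (Icc (0 : ℝ) 1) :=
    (hb.continuousOn.integrableOn_compact isCompact_Icc).mul_const e
  have hle : ∀ᵐ s ∂(volume.restrict (Icc (0 : ℝ) 1)), ‖z s * (derivWithin G (Icc 0 1) s + L s)‖ ≤ b s * e := by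
    rw [ae_restrict_iff' measurableSet_Icc]
    exact Eventually.of_forall fun s hs => by
      rw [Real.norm_eq_abs, abs_mul]
      exact mul_le_mul (hzb s) (hdef s hs) (abs_nonneg _) ((abs_nonneg _).trans (hzb s))
  have hI2 : IntegrableOn (fun s => z s * (derivWithin G (Icc 0 1) s + L s)) (Icc (0 : ℝ) 1) :=
    hbe.mono' (hzc.aestronglyMeasurable.restrict.mul ((hDc.aestronglyMeasurable measurableSet_Icc).add hLm)) hle
  have hsplit : (fun s => -z' s * G s + z s * L s) =
      fun s => -(z' s * G s + z s * derivWithin G (Icc 0 1) s) + z s * (derivWithin G (Icc 0 1) s + L s) := by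
    funext s; ring
  rw [hsplit, integral_add (hPc.integrableOn_compact isCompact_Icc).fun_neg hI2, integral_neg, hFTC, neg_zero,
    zero_add]
  have h := norm_integral_le_of_norm_le hbe hle
  rw [Real.norm_eq_abs, integral_mul_const] at h
  linarith

/-- Elementary weight arithmetic: `(M' + 2π M n) C q + M L q³ ≤ (M'C + 2πMC + ML) q⁴` for `1 ≤ q`,
`n ≤ q` and non-negative constants. [folklore] -/
theorem k2r_ref_fl_weight_arith {M M' C L q n : ℝ} (hM : 0 ≤ M) (hM' : 0 ≤ M') (hC : 0 ≤ C)
    (hL : 0 ≤ L) (hq : 1 ≤ q) (hn : n ≤ q) :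
    (M' + 2 * π * M * n) * (C * q) + M * (L * q ^ 3) ≤ (M' * C + 2 * π * M * C + M * L) * q ^ 4 := by
  have hq4 : q ≤ q ^ 4 := le_self_pow₀ hq (by norm_num)
  have hq34 : q ^ 3 ≤ q ^ 4 := pow_le_pow_right₀ hq (by norm_num)
  have hnq : n * q ≤ q ^ 4 :=
    calc n * q ≤ q * q := mul_le_mul_of_nonneg_right hn (zero_le_one.trans hq)
      _ = q ^ 2 := (sq q).symm
      _ ≤ q ^ 4 := pow_le_pow_right₀ hq (by norm_num)
  have e1 := mul_le_mul_of_nonneg_left hq4 (mul_nonneg hM' hC)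
  have e2 := mul_le_mul_of_nonneg_left hnq (mul_nonneg (mul_nonneg (by positivity : (0 : ℝ) ≤ 2 * π) hM) hC)
  have e3 := mul_le_mul_of_nonneg_left hq34 (mul_nonneg hM hL)
  nlinarith [e1, e2, e3]

/-! ## The stub -/

/-- **Stub `stub_flight` of line `refutation` of crux K2R `AdjointEnskogTestFamilyR` (registered signature,
verbatim): integration by parts along free flights, tested.**  For a jointly continuous `Φ` of quadratic
velocity growth that is `C¹` along every free flight of `𝕋³` on `[0,1]`, a jointly measurable `Ł` of
polynomial growth with `|∂_r Φ(r, x+(r-s)v, v)|_{r=s} + Ł(s,x,v)| ≤ η(1+|v|²)` on `[0,1] × 𝕋³ × ℝ³`, a test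
function `Z(s,x) = ζ(s) ξ(x)` with `ζ ∈ C¹` vanishing outside `(0,1)` and `ξ ∈ {cos 2πx₀, sin 2πx₀}`, and a
velocity weight `Θ` with `∫ |Θ|(1+|v|²)⁴ < ∞`:
`|∫₀¹∫∫ Θ(v) (-(∂_sZ + v·∇Z) Φ + Z Ł)| ≤ η ‖ζ‖_{L¹} ∫ |Θ|(1+|v|²)` (shear `x = y + sv` on the torus, Fubini,
and the one-dimensional integration by parts flight by flight). [folklore] -/
theorem stub_flight :
  ∀ (Φ Ł : ℝ → UnitAddTorus (Fin 3) → EuclideanSpace ℝ (Fin 3) → ℝ) (CΦ CL η : ℝ),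
    Continuous (fun p : ℝ × UnitAddTorus (Fin 3) × EuclideanSpace ℝ (Fin 3) => Φ p.1 p.2.1 p.2.2) →
    Measurable (fun p : ℝ × UnitAddTorus (Fin 3) × EuclideanSpace ℝ (Fin 3) => Ł p.1 p.2.1 p.2.2) →
    (∀ s x v, |Φ s x v| ≤ CΦ * (1 + ‖v‖ ^ 2)) →
    (∀ s ∈ Set.Icc (0 : ℝ) 1, ∀ x v, |Ł s x v| ≤ CL * (1 + ‖v‖ ^ 2) ^ 3) → 0 ≤ η →
    (∀ x v, ContDiffOn ℝ 1 (fun r => Φ r (x + Torus.proj (r • v)) v) (Set.Icc 0 1)) →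
    (∀ s ∈ Set.Icc (0 : ℝ) 1, ∀ x v,
      |derivWithin (fun r => Φ r (x + Torus.proj ((r - s) • v)) v) (Set.Icc 0 1) s + Ł s x v| ≤ η * (1 + ‖v‖ ^ 2)) →
    ∀ (ζ : ℝ → ℝ), ContDiff ℝ 1 ζ → (∀ s, s ≤ 0 ∨ 1 ≤ s → ζ s = 0) →
    ∀ (Θ : EuclideanSpace ℝ (Fin 3) → ℝ), Continuous Θ →
      Integrable (fun v => |Θ v| * (1 + ‖v‖ ^ 2) ^ 4) →
    ∀ trig : Bool,
    let ξ : UnitAddTorus (Fin 3) → ℝ := fun x => if trig then Torus.cosCoord 0 x else Torus.sinCoord 0 x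
    let ξ' : UnitAddTorus (Fin 3) → ℝ := fun x =>
      if trig then -(2 * Real.pi) * Torus.sinCoord 0 x else (2 * Real.pi) * Torus.cosCoord 0 x
    |∫ s in Set.Icc (0 : ℝ) 1, ∫ x : UnitAddTorus (Fin 3), ∫ v : EuclideanSpace ℝ (Fin 3),
        Θ v * (-(deriv ζ s * ξ x + ζ s * (v 0 * ξ' x)) * Φ s x v + ζ s * ξ x * Ł s x v)|
      ≤ η * (∫ s in Set.Icc (0 : ℝ) 1, |ζ s|) * ∫ v : EuclideanSpace ℝ (Fin 3), |Θ v| * (1 + ‖v‖ ^ 2) := by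
  intro Φ Ł CΦ CL η hΦc hŁm hΦb hŁb hη hdiff hdef ζ hζ hζ0 Θ hΘc hΘi trig ξ ξ'
  -- Step 0: constants and elementary bounds
  have hCΦ : 0 ≤ CΦ := by
    have h : (0 : ℝ) ≤ CΦ * (1 + ‖(0 : V3)‖ ^ 2) := (abs_nonneg _).trans (hΦb 0 0 0)
    simpa using h
  have hCL : 0 ≤ CL := by
    have h : (0 : ℝ) ≤ CL * (1 + ‖(0 : V3)‖ ^ 2) ^ 3 := (abs_nonneg _).trans (hŁb 0 ⟨le_rfl, zero_le_one⟩ 0 0)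
    simpa using h
  have hζc : Continuous ζ := hζ.continuous
  have hζ'c : Continuous (deriv ζ) := hζ.continuous_deriv le_rfl
  obtain ⟨Mζ, hMζ⟩ : ∃ M : ℝ, ∀ s ∈ Icc (0 : ℝ) 1, |ζ s| ≤ M := by
    obtain ⟨M, hM⟩ := isCompact_Icc.exists_bound_of_continuousOn (hζc.continuousOn (s := Icc (0 : ℝ) 1))
    exact ⟨M, fun s hs => by simpa only [Real.norm_eq_abs] using hM s hs⟩
  obtain ⟨Mζ', hMζ'⟩ : ∃ M : ℝ, ∀ s ∈ Icc (0 : ℝ) 1, |deriv ζ s| ≤ M := by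
    obtain ⟨M, hM⟩ := isCompact_Icc.exists_bound_of_continuousOn (hζ'c.continuousOn (s := Icc (0 : ℝ) 1))
    exact ⟨M, fun s hs => by simpa only [Real.norm_eq_abs] using hM s hs⟩
  have hMζ0 : 0 ≤ Mζ := (abs_nonneg _).trans (hMζ 0 ⟨le_rfl, zero_le_one⟩)
  have hMζ'0 : 0 ≤ Mζ' := (abs_nonneg _).trans (hMζ' 0 ⟨le_rfl, zero_le_one⟩)
  -- the profile `ξ`, `ξ'` at real representatives
  have hξrep : ∀ (x : T3) (t : ℝ), x 0 = (t : UnitAddCircle) →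
      ξ x = (if trig then Real.cos (2 * π * t) else Real.sin (2 * π * t)) ∧
      ξ' x = (if trig then -(2 * π) * Real.sin (2 * π * t) else (2 * π) * Real.cos (2 * π * t)) := by
    intro x t ht
    constructor
    · show (if trig then Torus.cosCoord 0 x else Torus.sinCoord 0 x) = _
      rw [Torus.cosCoord_of_eq ht, Torus.sinCoord_of_eq ht]
    · show (if trig then -(2 * π) * Torus.sinCoord 0 x else (2 * π) * Torus.cosCoord 0 x) = _
      rw [Torus.cosCoord_of_eq ht, Torus.sinCoord_of_eq ht]
  have hξb : ∀ x : T3, |ξ x| ≤ 1 ∧ |ξ' x| ≤ 2 * π := fun x => by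
    obtain ⟨t, ht⟩ := Torus.exists_coe_eq (x 0)
    rw [(hξrep x t ht.symm).1, (hξrep x t ht.symm).2]
    exact k2r_ref_fl_abs_prof_le trig t
  have hξc : Continuous ξ := continuous_if_const _ (fun _ => (Torus.isSmooth_cosCoord 0).continuous)
    (fun _ => (Torus.isSmooth_sinCoord 0).continuous)
  have hξ'c : Continuous ξ' :=
    continuous_if_const _ (fun _ => continuous_const.mul (Torus.isSmooth_sinCoord 0).continuous)
      (fun _ => continuous_const.mul (Torus.isSmooth_cosCoord 0).continuous)
  have hv0c : Continuous fun v : V3 => v 0 := (EuclideanSpace.proj (0 : Fin 3) (𝕜 := ℝ)).continuous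
  have hv0b : ∀ v : V3, |v 0| ≤ ‖v‖ := fun v => by simpa only [Real.norm_eq_abs] using PiLp.norm_apply_le v 0
  -- Step 1: the kernel `H(s, x, v)`, its measurability and its weighted bound on `[0,1]`
  have hHm0 : Measurable fun p : ℝ × T3 × V3 =>
      Θ p.2.2 * (-(deriv ζ p.1 * ξ p.2.1 + ζ p.1 * (p.2.2 0 * ξ' p.2.1)) * Φ p.1 p.2.1 p.2.2 +
        ζ p.1 * ξ p.2.1 * Ł p.1 p.2.1 p.2.2) := by
    have h3 : Continuous fun p : ℝ × T3 × V3 => ξ p.2.1 := hξc.comp continuous_snd.fst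
    have h4 : Continuous fun p : ℝ × T3 × V3 => ζ p.1 := hζc.comp continuous_fst
    have hA : Continuous fun p : ℝ × T3 × V3 =>
        -(deriv ζ p.1 * ξ p.2.1 + ζ p.1 * (p.2.2 0 * ξ' p.2.1)) * Φ p.1 p.2.1 p.2.2 :=
      (((hζ'c.comp continuous_fst).mul h3).add (h4.mul ((hv0c.comp continuous_snd.snd).mul
        (hξ'c.comp continuous_snd.fst)))).neg.mul hΦc
    exact (hΘc.comp continuous_snd.snd).measurable.mul (hA.measurable.add ((h4.mul h3).measurable.mul hŁm))
  obtain ⟨H, hH, hHm⟩ : ∃ H : ℝ × T3 × V3 → ℝ,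
      (∀ s x v, H (s, x, v) = Θ v * (-(deriv ζ s * ξ x + ζ s * (v 0 * ξ' x)) * Φ s x v + ζ s * ξ x * Ł s x v)) ∧
      Measurable H := ⟨_, fun _ _ _ => rfl, hHm0⟩
  have hHb : ∀ s ∈ Icc (0 : ℝ) 1, ∀ (x : T3) (v : V3),
      |H (s, x, v)| ≤ (Mζ' * CΦ + 2 * π * Mζ * CΦ + Mζ * CL) * (|Θ v| * (1 + ‖v‖ ^ 2) ^ 4) := by
    intro s hs x v
    have hq1 : (1 : ℝ) ≤ 1 + ‖v‖ ^ 2 := by nlinarith [norm_nonneg v]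
    have hvq : ‖v‖ ≤ 1 + ‖v‖ ^ 2 := by nlinarith [norm_nonneg v, sq_nonneg (‖v‖ - 1)]
    have h2π : (0 : ℝ) ≤ 2 * π := by positivity
    have hA : |-(deriv ζ s * ξ x + ζ s * (v 0 * ξ' x))| ≤ Mζ' + 2 * π * Mζ * ‖v‖ := by
      rw [abs_neg]
      calc |deriv ζ s * ξ x + ζ s * (v 0 * ξ' x)| ≤ |deriv ζ s * ξ x| + |ζ s * (v 0 * ξ' x)| := abs_add_le _ _
        _ = |deriv ζ s| * |ξ x| + |ζ s| * (|v 0| * |ξ' x|) := by rw [abs_mul, abs_mul, abs_mul]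
        _ ≤ Mζ' * 1 + Mζ * (‖v‖ * (2 * π)) :=
            add_le_add (mul_le_mul (hMζ' s hs) (hξb x).1 (abs_nonneg _) hMζ'0) (mul_le_mul (hMζ s hs)
              (mul_le_mul (hv0b v) (hξb x).2 (abs_nonneg _) (norm_nonneg _)) (by positivity) hMζ0)
        _ = Mζ' + 2 * π * Mζ * ‖v‖ := by ring
    have hA0 : 0 ≤ Mζ' + 2 * π * Mζ * ‖v‖ := add_nonneg hMζ'0 (mul_nonneg (mul_nonneg h2π hMζ0) (norm_nonneg _))
    calc |H (s, x, v)| = |Θ v| * |-(deriv ζ s * ξ x + ζ s * (v 0 * ξ' x)) * Φ s x v + ζ s * ξ x * Ł s x v| := by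
          rw [hH, abs_mul]
      _ ≤ |Θ v| * (|-(deriv ζ s * ξ x + ζ s * (v 0 * ξ' x))| * |Φ s x v| + |ζ s| * |ξ x| * |Ł s x v|) := by
          refine mul_le_mul_of_nonneg_left ?_ (abs_nonneg _)
          calc _ ≤ |-(deriv ζ s * ξ x + ζ s * (v 0 * ξ' x)) * Φ s x v| + |ζ s * ξ x * Ł s x v| := abs_add_le _ _
            _ = _ := by rw [abs_mul, abs_mul, abs_mul]
      _ ≤ |Θ v| * ((Mζ' + 2 * π * Mζ * ‖v‖) * (CΦ * (1 + ‖v‖ ^ 2)) + Mζ * 1 * (CL * (1 + ‖v‖ ^ 2) ^ 3)) := by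
          refine mul_le_mul_of_nonneg_left (add_le_add ?_ ?_) (abs_nonneg _)
          · exact mul_le_mul hA (hΦb s x v) (abs_nonneg _) hA0
          · exact mul_le_mul (mul_le_mul (hMζ s hs) (hξb x).1 (abs_nonneg _) hMζ0) (hŁb s hs x v)
              (abs_nonneg _) (by rw [mul_one]; exact hMζ0)
      _ ≤ |Θ v| * ((Mζ' * CΦ + 2 * π * Mζ * CΦ + Mζ * CL) * (1 + ‖v‖ ^ 2) ^ 4) := by
          refine mul_le_mul_of_nonneg_left ?_ (abs_nonneg _)
          rw [mul_one]
          exact k2r_ref_fl_weight_arith hMζ0 hMζ'0 hCΦ hCL hq1 hvq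
      _ = (Mζ' * CΦ + 2 * π * Mζ * CΦ + Mζ * CL) * (|Θ v| * (1 + ‖v‖ ^ 2) ^ 4) := by ring
  -- Step 2: integrability of `H` on `[0,1] × 𝕋³ × ℝ³` (measure `ds|[0,1] ⊗ (dy ⊗ dv)`); the LHS as one integral
  have hPae : ∀ᵐ p ∂((volume.restrict (Icc (0 : ℝ) 1)).prod ((volume : Measure T3).prod (volume : Measure V3))),
      p.1 ∈ Icc (0 : ℝ) 1 := by
    rw [Measure.restrict_prod_eq_prod_univ]
    filter_upwards [ae_restrict_mem (measurableSet_Icc.prod MeasurableSet.univ)] with p hp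
    exact hp.1
  have hdom : Integrable (fun p : ℝ × T3 × V3 => (1 : ℝ) * ((1 : ℝ) *
      ((Mζ' * CΦ + 2 * π * Mζ * CΦ + Mζ * CL) * (|Θ p.2.2| * (1 + ‖p.2.2‖ ^ 2) ^ 4))))
      ((volume.restrict (Icc (0 : ℝ) 1)).prod ((volume : Measure T3).prod (volume : Measure V3))) :=
    (integrable_const (1 : ℝ)).mul_prod ((integrable_const (1 : ℝ)).mul_prod (hΘi.const_mul _))
  have hHi : Integrable H
      ((volume.restrict (Icc (0 : ℝ) 1)).prod ((volume : Measure T3).prod (volume : Measure V3))) := by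
    refine hdom.mono' hHm.aestronglyMeasurable ?_
    filter_upwards [hPae] with p hp
    rw [Real.norm_eq_abs, one_mul, one_mul]
    exact hHb p.1 hp p.2.1 p.2.2
  have hLHS : (∫ s in Icc (0 : ℝ) 1, ∫ x : T3, ∫ v : V3, H (s, x, v)) =
      ∫ p, H p ∂((volume.restrict (Icc (0 : ℝ) 1)).prod ((volume : Measure T3).prod (volume : Measure V3))) := by
    rw [integral_prod H hHi]
    refine integral_congr_ae ?_
    filter_upwards [hHi.prod_right_ae] with s hs
    exact (integral_prod _ hs).symm
  -- Step 3: the shear `(s, y, v) ↦ (s, y + s v, v)` preserves `ds dy dv`; change variables; Fubini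
  have hσ : MeasurePreserving (fun p : ℝ × T3 × V3 => (p.1, (p.2.1 + Torus.proj (p.1 • p.2.2), p.2.2)))
      ((volume.restrict (Icc (0 : ℝ) 1)).prod ((volume : Measure T3).prod (volume : Measure V3)))
      ((volume.restrict (Icc (0 : ℝ) 1)).prod ((volume : Measure T3).prod (volume : Measure V3))) := by
    have hg : Measurable (Function.uncurry fun (s : ℝ) (q : T3 × V3) => (q.1 + Torus.proj (s • q.2), q.2)) := by
      have hc : Continuous fun p : ℝ × T3 × V3 => (p.2.1 + Torus.proj (p.1 • p.2.2), p.2.2) :=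
        (continuous_snd.fst.add (Torus.continuous_proj.comp (continuous_fst.smul continuous_snd.snd))).prodMk
          continuous_snd.snd
      exact hc.measurable
    refine (MeasurePreserving.id _).skew_product hg (Eventually.of_forall fun s => ?_)
    have hτ : Measurable (Function.uncurry fun (v : V3) (x : T3) => x + Torus.proj (s • v)) :=
      (continuous_snd.add (Torus.continuous_proj.comp (continuous_fst.const_smul s))).measurable
    exact (measurePreserving_shear (μ := (volume : Measure T3)) (ν := (volume : Measure V3))
      (fun (v : V3) (x : T3) => x + Torus.proj (s • v)) hτ (fun v => map_add_right_eq_self _ _)).map_eq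
  have hcov : ∫ p, H (p.1, (p.2.1 + Torus.proj (p.1 • p.2.2), p.2.2))
        ∂((volume.restrict (Icc (0 : ℝ) 1)).prod ((volume : Measure T3).prod (volume : Measure V3))) =
      ∫ p, H p ∂((volume.restrict (Icc (0 : ℝ) 1)).prod ((volume : Measure T3).prod (volume : Measure V3))) := by
    have h := integral_map hσ.measurable.aemeasurable (hHm.aestronglyMeasurable
      (μ := Measure.map (fun p : ℝ × T3 × V3 => (p.1, (p.2.1 + Torus.proj (p.1 • p.2.2), p.2.2)))
        ((volume.restrict (Icc (0 : ℝ) 1)).prod ((volume : Measure T3).prod (volume : Measure V3)))))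
    rw [hσ.map_eq] at h
    exact h.symm
  have hflights : ∫ p, H (p.1, (p.2.1 + Torus.proj (p.1 • p.2.2), p.2.2))
        ∂((volume.restrict (Icc (0 : ℝ) 1)).prod ((volume : Measure T3).prod (volume : Measure V3))) =
      ∫ q : T3 × V3, (∫ s in Icc (0 : ℝ) 1, H (s, (q.1 + Torus.proj (s • q.2), q.2)))
        ∂((volume : Measure T3).prod (volume : Measure V3)) :=
    integral_prod_symm _ ((hσ.integrable_comp hHm.aestronglyMeasurable).2 hHi)
  -- Step 4: integration by parts flight by flight
  have hflight : ∀ (y : T3) (v : V3), |∫ s in Icc (0 : ℝ) 1, H (s, (y + Torus.proj (s • v), v))| ≤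
      (η * ∫ s in Icc (0 : ℝ) 1, |ζ s|) * (|Θ v| * (1 + ‖v‖ ^ 2)) := by
    intro y v
    -- a real representative of the `0`-th coordinate along the flight, and the profile `c = ξ`, `c' = ξ'`
    obtain ⟨y0, hy0⟩ : ∃ y0 : ℝ, ∀ r : ℝ, (y + Torus.proj (r • v)) 0 = ((y0 + r * v 0 : ℝ) : UnitAddCircle) := by
      obtain ⟨y0, hy0⟩ := Torus.exists_coe_eq (y 0)
      refine ⟨y0, fun r => ?_⟩
      have e : (y + Torus.proj (r • v)) 0 = y 0 + (((r * v 0 : ℝ)) : UnitAddCircle) := rfl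
      rw [e, ← hy0, ← AddCircle.coe_add]
    obtain ⟨c, hc⟩ : ∃ c : ℝ → ℝ, ∀ r, c r =
        (if trig then Real.cos (2 * π * (y0 + r * v 0)) else Real.sin (2 * π * (y0 + r * v 0))) :=
      ⟨_, fun _ => rfl⟩
    obtain ⟨c', hc'⟩ : ∃ c' : ℝ → ℝ, ∀ r, c' r = (if trig then -(2 * π) * Real.sin (2 * π * (y0 + r * v 0))
        else (2 * π) * Real.cos (2 * π * (y0 + r * v 0))) := ⟨_, fun _ => rfl⟩
    have hξfl : ∀ r, ξ (y + Torus.proj (r • v)) = c r := fun r => by rw [hc]; exact (hξrep _ _ (hy0 r)).1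
    have hξ'fl : ∀ r, ξ' (y + Torus.proj (r • v)) = c' r := fun r => by rw [hc']; exact (hξrep _ _ (hy0 r)).2
    have hcd : ∀ r, HasDerivAt c (c' r * v 0) r := by
      intro r
      have hlin : HasDerivAt (fun r : ℝ => y0 + r * v 0) (v 0) r := by
        simpa using ((hasDerivAt_id r).mul_const (v 0)).const_add y0
      rw [hc']
      exact ((k2r_ref_fl_hasDerivAt_prof trig (y0 + r * v 0)).comp r hlin).congr_of_eventuallyEq
        (Eventually.of_forall fun r => (hc r).trans rfl)
    have hcc : Continuous c := continuous_iff_continuousAt.2 fun r => (hcd r).continuousAt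
    have hc'c : Continuous c' := by
      rw [show c' = _ from funext hc']
      exact continuous_if_const _ (fun _ => by fun_prop) (fun _ => by fun_prop)
    -- `z = ζ c`, its derivative `z' = ζ' c + ζ v₀ c'`, `z(0) = z(1) = 0`, `|z| ≤ |ζ|`
    have hzd : ∀ r, HasDerivAt (fun r => ζ r * c r) (deriv ζ r * c r + ζ r * (v 0 * c' r)) r := fun r =>
      ((((hζ.differentiable one_ne_zero) r).hasDerivAt).mul (hcd r)).congr_deriv (by ring)
    have hz'c : Continuous (fun r => deriv ζ r * c r + ζ r * (v 0 * c' r)) :=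
      (hζ'c.mul hcc).add (hζc.mul (continuous_const.mul hc'c))
    have hz0 : ζ 0 * c 0 = 0 := by rw [hζ0 0 (Or.inl le_rfl), zero_mul]
    have hz1 : ζ 1 * c 1 = 0 := by rw [hζ0 1 (Or.inr le_rfl), zero_mul]
    have hzb : ∀ s, |ζ s * c s| ≤ |ζ s| := fun s => by
      rw [abs_mul, hc]
      exact mul_le_of_le_one_right (abs_nonneg _) (k2r_ref_fl_abs_prof_le trig _).1
    -- the flight data `L(r) = Ł(r, y + rv, v)` and the defect inequality along the flight
    have hflc : Continuous fun r : ℝ => ((r, y + Torus.proj (r • v), v) : ℝ × T3 × V3) :=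
      continuous_id.prodMk ((continuous_const.add
        (Torus.continuous_proj.comp (continuous_id.smul continuous_const))).prodMk continuous_const)
    have hdef' : ∀ s ∈ Icc (0 : ℝ) 1,
        |derivWithin (fun r => Φ r (y + Torus.proj (r • v)) v) (Icc 0 1) s + Ł s (y + Torus.proj (s • v)) v| ≤
          η * (1 + ‖v‖ ^ 2) := by
      intro s hs
      have e : (fun r => Φ r (y + Torus.proj (s • v) + Torus.proj ((r - s) • v)) v) =
          fun r => Φ r (y + Torus.proj (r • v)) v := by
        funext r
        rw [add_assoc, ← Torus.proj_add, ← add_smul, add_sub_cancel]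
      simpa only [e] using hdef s hs (y + Torus.proj (s • v)) v
    have key := k2r_ref_fl_flight_ibp (L := fun r => Ł r (y + Torus.proj (r • v)) v) (hdiff y v) hzd hz'c hz0 hz1
      hζc.abs hzb (hŁm.comp hflc.measurable).aestronglyMeasurable hdef'
    have hpt : (fun s => H (s, (y + Torus.proj (s • v), v))) = fun s =>
        Θ v * (-(deriv ζ s * c s + ζ s * (v 0 * c' s)) * Φ s (y + Torus.proj (s • v)) v +
          ζ s * c s * Ł s (y + Torus.proj (s • v)) v) := by
      funext s
      rw [hH, hξfl, hξ'fl]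
    rw [hpt, integral_const_mul, abs_mul]
    calc |Θ v| * |∫ s in Icc (0 : ℝ) 1, (-(deriv ζ s * c s + ζ s * (v 0 * c' s)) * Φ s (y + Torus.proj (s • v)) v +
          ζ s * c s * Ł s (y + Torus.proj (s • v)) v)|
        ≤ |Θ v| * (η * (1 + ‖v‖ ^ 2) * ∫ s in Icc (0 : ℝ) 1, |ζ s|) := mul_le_mul_of_nonneg_left key (abs_nonneg _)
      _ = (η * ∫ s in Icc (0 : ℝ) 1, |ζ s|) * (|Θ v| * (1 + ‖v‖ ^ 2)) := by ring
  -- Step 5: integrate the flight bound over `𝕋³ × ℝ³`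
  have hΘ1 : Integrable (fun v : V3 => |Θ v| * (1 + ‖v‖ ^ 2)) := by
    refine hΘi.mono' ((continuous_abs.comp hΘc).mul
      (continuous_const.add (continuous_norm.pow 2))).aestronglyMeasurable (Eventually.of_forall fun v => ?_)
    have hq1 : (1 : ℝ) ≤ 1 + ‖v‖ ^ 2 := by nlinarith [norm_nonneg v]
    rw [Real.norm_eq_abs, abs_mul, abs_abs, abs_of_pos (by positivity : (0 : ℝ) < 1 + ‖v‖ ^ 2)]
    exact mul_le_mul_of_nonneg_left (le_self_pow₀ hq1 (by norm_num)) (abs_nonneg _)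
  have hbi : Integrable (fun q : T3 × V3 =>
      (1 : ℝ) * ((η * ∫ s in Icc (0 : ℝ) 1, |ζ s|) * (|Θ q.2| * (1 + ‖q.2‖ ^ 2))))
      ((volume : Measure T3).prod (volume : Measure V3)) := (integrable_const (1 : ℝ)).mul_prod (hΘ1.const_mul _)
  have hfin : |∫ q : T3 × V3, (∫ s in Icc (0 : ℝ) 1, H (s, (q.1 + Torus.proj (s • q.2), q.2)))
      ∂((volume : Measure T3).prod (volume : Measure V3))| ≤
      (η * ∫ s in Icc (0 : ℝ) 1, |ζ s|) * ∫ v : V3, |Θ v| * (1 + ‖v‖ ^ 2) := by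
    have h := norm_integral_le_of_norm_le hbi
      (Eventually.of_forall fun q => by rw [Real.norm_eq_abs, one_mul]; exact hflight q.1 q.2)
    have e := integral_prod_mul (μ := (volume : Measure T3)) (ν := (volume : Measure V3)) (fun _ : T3 => (1 : ℝ))
      (fun v : V3 => (η * ∫ s in Icc (0 : ℝ) 1, |ζ s|) * (|Θ v| * (1 + ‖v‖ ^ 2)))
    rwa [Real.norm_eq_abs, e, integral_const, smul_eq_mul, mul_one, probReal_univ, one_mul,
      integral_const_mul] at h
  have final : |∫ s in Icc (0 : ℝ) 1, ∫ x : T3, ∫ v : V3, H (s, x, v)| ≤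
      η * (∫ s in Icc (0 : ℝ) 1, |ζ s|) * ∫ v : V3, |Θ v| * (1 + ‖v‖ ^ 2) := by
    rw [hLHS, ← hcov, hflights]
    exact hfin
  simpa only [hH] using final

end Summit.AtomisticToContinuum.HydrodynamicLimit.Theorems.EnskogAdjointDuality

end
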